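import Summits.BirchSwinnertonDyer.BirchSwinnertonDyer.Theorems.ByReductionTypeAtTwoMultTowerSplitOrderTransport
import Summits.BirchSwinnertonDyer.BirchSwinnertonDyer.Theorems.ByReductionTypeAtTwoMultTowerNS2TwoAdicUnits
import Literature.NumberTheory.EllipticCurves.SelmerCorankControlRatProofs
import Mathlib.GroupTheory.Archimedean
import Mathlib.Data.Fintype.Pigeonhole
import HarnessLib

/-!
# Route `ByReductionTypeAtTwo`, crux `MultUpperHalfAtTwo` (item stmt-BirchSwinnertonDyer-19922), TOWER road, the
# SPLIT rows: KERNEL BRICK S4a — preliminaries for the split ORDER bound: the pigeonhole in a subgroup of `ℤ`,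
# split reduction at the place `v ∋ p`, the ring isomorphism `ℚ_v ≃ ℚ_p` carrying Tate parameters, `ℚ₂ˣ ∩ {‖x‖<1} ⊆ 2^ℕ ℤ₂ˣ`

HONEST FRAMING (cell `bsd-2adic`, run/shared/lean/pub/bsd-2adic/, seat `bsd-2adic-mult` GEN 13, HUMAN RULINGS
D-0036 / D-0054 / D-0074): TOOL theorems only (no definition, no named fact, no `sorry`); closes nothing by itself;
nothing booked; BSD is not proved by any of this. Small lemmas consumed by the count
(`ByReductionTypeAtTwoMultTowerSplitOrderCount.lean`) and the kernel theorem (`…SplitOrderBound.lean`) of the split ORDER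
bound `#𝒦_{v,n}[2^∞] ≤ 2^k` (the projection of the PRINT named fact
`Greenberg1999.sec3_natCard_localTowerKerPrimary_splitMultiplicative_rat` consumed by `MultTowerCert.atTwo_le_pow_of_split`).

* `exists_ne_modEq_of_mem_addSubgroup` — if `S ≤ ℤ` contains `2^R` (`R = j + w + 1`) and no `2^j · odd`, then among
  `N > 2^w` elements of `S` two are congruent mod `2^R` (`S = 2^c ℤ`, `j < c ≤ R`; Mathlib `Int.subgroup_cyclic`);
* `hasSplitMultiplicativeReductionAt_of_atPrime` — split at the rational prime `p` ⇒ split at the place `v ∋ p`;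
* `exists_ringEquiv_tateParameter` — a ring isomorphism `e : ℚ_v ≃ ℚ_p` with `e(q) = Dq.q` for every local Tate parameter
  `q` (`tateJ q = j(W)`, `‖q‖ < 1`) and every `Dq : TateParameterData W p` (BRICK S3 `padicEquiv_eq_tateParameter`);
* `exists_eq_two_pow_mul_units` — `x ∈ ℚ₂`, `x ≠ 0`, `‖x‖ < 1` ⇒ `x = 2^k u`, `k ∈ ℕ`, `u ∈ ℤ₂ˣ`.

References: R. Greenberg, LNM 1716 (1999), §3 pp. 92–93; J. Silverman, GTM 151, Lemma V.5.1, Thm. V.5.3.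
-/

set_option autoImplicit false
-- the Theorems namespace of this sub repeats the summit name by design (D-0017 nested layout: Summit.<S>.<Sub>)
set_option linter.dupNamespace false

noncomputable section

open scoped Classical

namespace Summit.BirchSwinnertonDyer.BirchSwinnertonDyer.Theorems.MultTowerSplitOrder

open NumberField IsDedekindDomain Field WeierstrassCurve PadicInt Rat.HeightOneSpectrum
  Literature.NumberTheory.EllipticCurves Literature.NumberTheory.GaloisRepresentations
  Summit.BirchSwinnertonDyer.BirchSwinnertonDyer.Theorems.MultTowerNS2

attribute [local instance]
  Literature.NumberTheory.GaloisRepresentations.Ultrametric.AdicCompletion.nontriviallyNormedField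

/-! ### Arithmetic preliminaries -/

/-- **Pigeonhole in a subgroup of `ℤ`.** If `S ≤ ℤ` contains `2^R`, `R = j + w + 1`, and contains no `2^j · a` with `a`
odd, then among `N > 2^w` elements of `S` two are congruent mod `2^R` (`S = 2^c ℤ` with `j < c ≤ R`). [folklore] -/
theorem exists_ne_modEq_of_mem_addSubgroup (S : AddSubgroup ℤ) {R j w : ℕ} (hR : R = j + w + 1)
    (hmem : ((2 : ℤ) ^ R) ∈ S) (hnot : ∀ a : ℕ, Odd a → ((2 : ℤ) ^ j * a) ∉ S)
    {N : ℕ} (hN : 2 ^ w < N) (b : Fin N → ℤ) (hb : ∀ i, b i ∈ S) :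
    ∃ i i' : Fin N, i ≠ i' ∧ b i ≡ b i' [ZMOD (2 : ℤ) ^ R] := by
  obtain ⟨d, hd⟩ := Int.subgroup_cyclic S
  have hmemS : ∀ x : ℤ, x ∈ S ↔ (d.natAbs : ℤ) ∣ x := by
    intro x
    rw [hd, AddSubgroup.mem_closure_singleton, Int.natAbs_dvd]
    constructor
    · rintro ⟨n, rfl⟩
      exact ⟨n, by rw [smul_eq_mul, mul_comm]⟩
    · rintro ⟨n, rfl⟩
      exact ⟨n, by rw [smul_eq_mul, mul_comm]⟩
  -- `|d| = 2^c` with `j < c ≤ R`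
  have hdvd : d.natAbs ∣ 2 ^ R := by
    have h := (hmemS _).mp hmem
    exact_mod_cast Int.natAbs_dvd_natAbs.mpr h
  obtain ⟨c, hcR, hc⟩ := (Nat.dvd_prime_pow Nat.prime_two).mp hdvd
  have hjc : j < c := by
    by_contra hle
    push Not at hle
    apply hnot 1 odd_one
    rw [hmemS, hc, Nat.cast_one, mul_one]
    exact_mod_cast pow_dvd_pow 2 hle
  -- `b i = 2^c * t i`
  have ht : ∀ i, ∃ t : ℤ, b i = (2 : ℤ) ^ c * t := fun i ↦ by
    obtain ⟨t, ht⟩ := (hmemS _).mp (hb i)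
    exact ⟨t, by rw [ht, hc]; push_cast; ring⟩
  choose t ht using ht
  -- pigeonhole on `t i mod 2^(R - c)`
  have hcard : Fintype.card (ZMod (2 ^ (R - c))) < Fintype.card (Fin N) := by
    rw [ZMod.card, Fintype.card_fin]
    calc 2 ^ (R - c) ≤ 2 ^ w := Nat.pow_le_pow_right (by norm_num) (by omega)
      _ < N := hN
  obtain ⟨i, i', hii', h⟩ := Fintype.exists_ne_map_eq_of_card_lt (fun i ↦ (t i : ZMod (2 ^ (R - c)))) hcard
  refine ⟨i, i', hii', ?_⟩
  have hmod : t i ≡ t i' [ZMOD ((2 ^ (R - c) : ℕ) : ℤ)] := (ZMod.intCast_eq_intCast_iff _ _ _).mp h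
  have h2 := Int.ModEq.mul_left' (c := (2 : ℤ) ^ c) hmod
  rw [← ht, ← ht] at h2
  have hRc : (2 : ℤ) ^ c * (((2 ^ (R - c) : ℕ)) : ℤ) = (2 : ℤ) ^ R := by
    push_cast
    rw [← pow_add, Nat.add_sub_cancel' hcR]
  rwa [hRc] at h2

/-- Split multiplicative reduction at the rational prime `p` gives it at the place `v ∋ p` (Mathlib's `ℚ_v ≃ ℚ_p`;
the tree's `hasSplitMultiplicativeReductionAtPrime_iff_hasSplitMultiplicativeReductionAt`). [folklore] -/
theorem hasSplitMultiplicativeReductionAt_of_atPrime (W : WeierstrassCurve ℚ) [W.IsElliptic] {p : ℕ} [Fact p.Prime]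
    (v : HeightOneSpectrum (𝓞 ℚ)) (hv : ((p : ℕ) : 𝓞 ℚ) ∈ v.asIdeal) (h : W.HasSplitMultiplicativeReductionAtPrime p) :
    W.HasSplitMultiplicativeReductionAt v := by
  obtain rfl : ((primesEquiv v : Nat.Primes) : ℕ) = p := primesEquiv_eq_of_natCast_mem v (Fact.out) hv
  exact (hasSplitMultiplicativeReductionAtPrime_iff_hasSplitMultiplicativeReductionAt W v).mp h

/-- **A ring isomorphism `ℚ_v ≃ ℚ_p` (`v ∋ p`) carrying every local Tate parameter to THE Tate parameter of any
`TateParameterData` at `p`** (Mathlib's `padicEquiv v`, BRICK S3 `padicEquiv_eq_tateParameter`). [folklore] -/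
theorem exists_ringEquiv_tateParameter (p : ℕ) [Fact p.Prime] (v : HeightOneSpectrum (𝓞 ℚ))
    (hv : ((p : ℕ) : 𝓞 ℚ) ∈ v.asIdeal) :
    ∃ e : v.adicCompletion ℚ ≃+* ℚ_[p], ∀ (W : WeierstrassCurve ℚ) [W.IsElliptic] (q : v.adicCompletion ℚ),
      q ≠ 0 → ‖q‖ < 1 → tateJ q = algebraMap ℚ (v.adicCompletion ℚ) W.j →
        ∀ Dq : TateParameterData W p, e q = Dq.q := by
  obtain rfl : ((primesEquiv v : Nat.Primes) : ℕ) = p := primesEquiv_eq_of_natCast_mem v (Fact.out) hv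
  exact ⟨(adicCompletion.padicEquiv (R := 𝓞 ℚ) v).toAlgEquiv.toRingEquiv,
    fun W _ q hq0 hq hqj Dq ↦ padicEquiv_eq_tateParameter W v hq0 hq hqj Dq⟩

/-- `ℚ₂ˣ ∩ {‖x‖ < 1} ⊆ 2^{ℕ} · ℤ₂ˣ`: a non-zero `x ∈ ℚ₂` with `‖x‖ < 1` is `2^k · u`, `k ∈ ℕ`, `u` a unit. [folklore] -/
theorem exists_eq_two_pow_mul_units {x : ℚ_[2]} (hx0 : x ≠ 0) (hx : ‖x‖ < 1) :
    ∃ (k : ℕ) (u : ℤ_[2]ˣ), x = (2 : ℚ_[2]) ^ k * ((u : ℤ_[2]) : ℚ_[2]) := by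
  obtain ⟨j, u, hju⟩ := exists_eq_two_zpow_mul_units x hx0
  have hj : 0 ≤ j := by
    by_contra hneg
    push Not at hneg
    have hn : ‖x‖ = (2 : ℝ) ^ (-j) := by
      rw [hju, norm_mul, norm_two_zpow_padic, show ‖((u : ℤ_[2]) : ℚ_[2])‖ = 1 from PadicInt.norm_units u, mul_one]
    have : (1 : ℝ) ≤ (2 : ℝ) ^ (-j) := one_le_zpow₀ (by norm_num) (by omega)
    linarith
  refine ⟨j.toNat, u, ?_⟩
  rw [hju, ← zpow_natCast, Int.toNat_of_nonneg hj]

end Summit.BirchSwinnertonDyer.BirchSwinnertonDyer.Theorems.MultTowerSplitOrder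

end
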